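import Summits.SmoothPoincare4.SmoothPoincare4.Theses.AngleDefectCertificates
import Literature.Geometry.Riemannian.AlmostNonnegativeCurvatureSmoothing

/-!
# Birth skeleton for crux `AngleDefectCertificates.PolyhedralSphereRecognition`
(item stmt-SmoothPoincare4-11225, route `route-SmoothPoincare4-AngleDefectCertificates`, crux rank 2;
skeleton registrar, 2026-08-17)

Crux (FIXED, concluded below BY NAME, never restated): a Hausdorff second-countable SIMPLY CONNECTED
smooth 4-manifold `M` (C^∞ on `ℝ⁴`) carrying an angle-defect certificate for its own smooth
structure — a finite simplicial complex `K ⊂ ℝᴺ` pure of dimension 4, a homeomorphism `|K| ≃ₜ M`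
that is a smooth immersion on each closed simplex, symmetric unit-diagonal spherical cosines `c`
with every 4-face Gram matrix positive definite and every triangle's spherical dihedral-angle sum
`≤ 2π` (a smooth-compatible `CBB(1)` polyhedral metric) — is diffeomorphic to `S⁴`.

## The line — the route's own two-layer plan, cut at `Rm ≥ 0` (BCRW branch)

The route header (§ Two-layer plan / § Not decomposed yet) foresees
`PolyhedralSphereRecognition ⇐ smoothing (LinkSmoothing → ConeDesingularisation → BCRWUpgrade) →
Hamilton`. Typed against the tree's Riemannian vocabulary this gives FOUR stubs, the seam placed at
NON-NEGATIVE curvature operator — exactly what Bamler–Cabezas-Rivas–Wilking deliver — so that the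
strict-positivity upgrade (Hamilton's strong maximum principle) is NOT asked of the smoothing prover
but sits where it is printed, inside Hamilton's 1986 `Rm ≥ 0` classification, fed by the route's
own topological prediction `b₂ = 0` (Cheeger 1986):

* `stub_almostNonnegSmoothing` (S1, HARDEST, the open kernel = Petrunin's smoothing problem for
  4-dimensional `CBB(1)` polyhedral PL manifolds in its WEAK, non-collapsed, almost-non-negative form;
  weaker than the route's support item `PolyhedralPCORecognition` restricted to `π₁ = 1`): a compact
  simply connected certified `M` carries, for some `D, v₀ > 0` and EVERY `ε > 0`, a `C^∞` Riemannian
  metric `g_ε` ON THE SAME SMOOTH STRUCTURE with `diam ≤ D`, `vol ≥ v₀` and curvature operator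
  `Rm ≥ −ε` (`HasCurvatureOperatorGe`, the hypothesis shape of the tree's BCRW fact). Intended proof:
  smooth the spherical cone structure stratum by stratum — open 4-simplices are round; codimension 2
  (open triangles, cone angle ≤ 2π): doubly-warped rounding, curvature operator ≥ 1 − ε
  (Lavoyer2026, arXiv:2305.00344); edges/vertices: links are `CBB(1)` polyhedral 2- and 3-spheres,
  smoothed by LMPS in dimension 3 (arXiv:1411.0307 Thm 1.1, κ = 1) and coned off with expander-type
  tips (GianniotisSchulze2018 arXiv:1610.09753 Thm 1.1, Deruelle2016), volume and diameter converging
  to those of the polyhedral metric. [ShevchishinEtAl2015 = arXiv:1411.0307; Petrunin2003;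
  Lavoyer2026; GianniotisSchulze2018; AlexanderKapovitchPetrunin2024]
* `stub_bcrwSmoothing` (S2, KNOWN in print, Literature debt BY NAME): the tree's named fact
  `Literature.Geometry.Riemannian.BamlerCabezasRivasWilking2019_cor3_nonnegativeCurvatureOperator`
  (Invent. Math. 217 (2019), arXiv:1707.03002, Corollary 3 case (1): `diam ≤ D`, `vol ≥ v₀`,
  `Rm ≥ −ε(n, v₀, D)` on a closed manifold ⇒ a metric with `Rm ≥ 0` on the same manifold).
* `stub_certificateKillsSecondHomology` (B, KNOWN = Cheeger1986 LNM 1201 Thm 3(ii), polyhedral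
  Bochner; the route's support item stmt-SmoothPoincare4-11383 BY NAME): a certified simply connected
  closed 4-manifold has `H₂(M; ℤ) = 0`.
* `stub_nonnegCurvatureSphereRecognition` (R, KNOWN = Hamilton1986 Thm 1.3 + homology of the
  models): a closed simply connected smooth 4-manifold with a `C^∞` Riemannian metric of
  non-negative curvature operator and `H₂(M; ℤ) = 0` is diffeomorphic to `S⁴` — by the tree's named
  fact `hamilton1986_nonnegCurvatureOperator_four` (a): `M ≅ S⁴`, `ℂP²` or `S² × S²`, and
  `H₂(ℂP²) = ℤ`, `H₂(S² × S²) = ℤ²` (HatcherAT2002); equivalently Hurewicz–Whitehead make `M` a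
  homotopy 4-sphere and (b) of the same fact applies.

`PolyhedralSphereRecognition_of` proves the crux BY NAME from the four stubs; its own proof term is
`sorry`-free (compactness of `M` is PROVED here: `|K|` is a finite union of convex hulls of finite
sets, hence compact, and `|K| ≃ₜ M`; the Borel σ-algebra is installed to speak of volume). The only
`sorry`s of the file are the four stub bodies (sorry count 4 = stub count).

## Disproof.lean honoured / negatives

`ledger crux ls stmt-SmoothPoincare4-11225` (2026-08-17): no workfiles, no `Disproof.lean`; no
`Theorems/PolyhedralSphereRecognition/Negative/`; `ledger negatives --problem SmoothPoincare4`: see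
the registrar's NOTES (nothing bears on these stubs). No stub is an instance of a landed Negative lemma.
-/

noncomputable section

-- the prescribed namespace `Summit.<P>.<Sub>.…` duplicates `SmoothPoincare4` (P = Sub)
set_option linter.dupNamespace false

open scoped BigOperators Topology Manifold Classical MeasureTheory Matrix InnerProductSpace ContinuousMap ContDiff
open Filter Set Function TopologicalSpace MeasureTheory

namespace Summit.SmoothPoincare4.SmoothPoincare4.Cruxes.PolyhedralSphereRecognition.Birth

open Literature.Geometry.Lorentzian (PseudoRiemannianMetric)
open Summit.SmoothPoincare4.SmoothPoincare4.Theses.AngleDefectCertificates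
  (PolyhedralSphereRecognition CertificateKillsSecondHomology)

/-! ## Stub S1 — almost-non-negative, non-collapsed smoothing of a certificate (HARDEST, open) -/

/-- **Stub S1 (almost-non-negative smoothing on the same smooth structure).** For a compact,
Hausdorff, second countable, simply connected smooth 4-manifold `M` (Borel σ-algebra) carrying an
angle-defect certificate (verbatim the crux's hypothesis) there are `D, v₀ > 0` such that for every
`ε > 0` some `C^∞` Riemannian metric `g` on `M` has `diam_g(M) ≤ D` (`riemEDist ≤ D`),
`vol_g(M) ≥ v₀` (`riemVolume univ ≥ v₀`) and curvature operator `Rm_g ≥ −ε`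
(`HasCurvatureOperatorGe g ε`). Petrunin's smoothing problem (arXiv:1411.0307, Conj. 2 / Question 4)
for 4-dimensional spherical polyhedral PL manifolds in the weak form that Bamler–Cabezas-Rivas–Wilking
consume; compactness is a hypothesis here (the skeleton proves it from the certificate).
[cite: ShevchishinEtAl2015; Petrunin2003; Lavoyer2026; GianniotisSchulze2018; BamlerCabezasrivasWilking2019] -/
theorem stub_almostNonnegSmoothing :
    ∀ (M : Type) [TopologicalSpace M] [T2Space M] [SecondCountableTopology M] [CompactSpace M]
      [MeasurableSpace M] [BorelSpace M]
      [ChartedSpace (EuclideanSpace ℝ (Fin 4)) M] [IsManifold (𝓡 4) ∞ M] [SimplyConnectedSpace M],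
      (∃ (N : ℕ) (K : Geometry.SimplicialComplex ℝ (EuclideanSpace ℝ (Fin N))) (h : K.space ≃ₜ M) (c : EuclideanSpace ℝ (Fin N) → EuclideanSpace ℝ (Fin N) → ℝ), K.faces.Finite ∧ (∀ s ∈ K.faces, ∃ σ ∈ K.faces, s ⊆ σ ∧ σ.card = 5) ∧ (∀ s ∈ K.faces, ∃ (g : EuclideanSpace ℝ (Fin N) → M) (u : Set (EuclideanSpace ℝ (Fin N))), IsOpen u ∧ convexHull ℝ (s : Set (EuclideanSpace ℝ (Fin N))) ⊆ u ∧ ContMDiffOn 𝓘(ℝ, EuclideanSpace ℝ (Fin N)) (𝓡 4) ∞ g u ∧ (∀ y : K.space, (y : EuclideanSpace ℝ (Fin N)) ∈ convexHull ℝ (s : Set (EuclideanSpace ℝ (Fin N))) → h y = g y) ∧ ∀ x ∈ convexHull ℝ (s : Set (EuclideanSpace ℝ (Fin N))), Set.InjOn (mfderiv 𝓘(ℝ, EuclideanSpace ℝ (Fin N)) (𝓡 4) g x) (vectorSpan ℝ (s : Set (EuclideanSpace ℝ (Fin N))) : Set (EuclideanSpace ℝ (Fin N)))) ∧ (∀ a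 b, c a b = c b a) ∧ (∀ a, c a a = 1) ∧ (∀ σ ∈ K.faces, σ.card = 5 → (Matrix.of fun a b : σ => c a b).PosDef) ∧ (∀ t ∈ K.faces, t.card = 3 → ∑ᶠ σ ∈ {σ : Finset (EuclideanSpace ℝ (Fin N)) | σ ∈ K.faces ∧ t ⊆ σ ∧ σ.card = 5}, (∑ a : σ, ∑ b : σ, if (a : EuclideanSpace ℝ (Fin N)) ∉ t ∧ (b : EuclideanSpace ℝ (Fin N)) ∉ t ∧ a ≠ b then Real.arccos (-((Matrix.of fun a b : σ => c a b)⁻¹ a b / Real.sqrt ((Matrix.of fun a b : σ => c a b)⁻¹ a a * (Matrix.of fun a b : σ => c a b)⁻¹ b b))) / 2 else 0) ≤ 2 * Real.pi)) →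
      ∃ D v₀ : ℝ, 0 < D ∧ 0 < v₀ ∧ ∀ ε : ℝ, 0 < ε →
        ∃ g : PseudoRiemannianMetric (𝓡 4) ∞ (EuclideanSpace ℝ (Fin 4)) (TangentSpace (𝓡 4) : M → Type _),
          g.IsRiemannian ∧ (∀ x y : M, g.riemEDist x y ≤ ENNReal.ofReal D) ∧
            ENNReal.ofReal v₀ ≤ g.riemVolume Set.univ ∧ g.HasCurvatureOperatorGe ε := by
  sorry

/-! ## Stub S2 — Bamler–Cabezas-Rivas–Wilking 2019, Corollary 3 (1) (KNOWN; Literature debt by name) -/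

/-- **Stub S2 (BCRW smoothing, the tree's named fact BY NAME).** Almost non-negative curvature
operator + `diam ≤ D` + `vol ≥ v₀` on a closed manifold ⇒ a smooth Riemannian metric with
non-negative curvature operator on the same manifold (Invent. Math. 217 (2019) 95–126, Cor. 3,
case (1); unproved in tree — discharging it closes this stub by `exact`).
[cite: BamlerCabezasrivasWilking2019, Corollary 3] -/
theorem stub_bcrwSmoothing :
    Literature.Geometry.Riemannian.BamlerCabezasRivasWilking2019_cor3_nonnegativeCurvatureOperator := by
  sorry

/-! ## Stub B — polyhedral Bochner: a certificate kills `H₂` (KNOWN = Cheeger 1986; route support item by name) -/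

/-- **Stub B (= the route's support item `CertificateKillsSecondHomology`, stmt-SmoothPoincare4-11383,
BY NAME).** A closed simply connected smooth 4-manifold with an angle-defect certificate has
`H₂(M; ℤ) = 0` (Cheeger, LNM 1201 (1986), Thm 3(ii): a closed piecewise-constant-curvature space
with curvature ≥ 0 in Cheeger's sense is a real homology sphere or carries parallel forms; with
`K ≡ 1` pieces the Weitzenböck term is strictly positive). Proving that item closes this stub by
`exact`. [cite: Cheeger1986, Thm 3(ii)] -/
theorem stub_certificateKillsSecondHomology : CertificateKillsSecondHomology := by
  sorry

/-! ## Stub R — `Rm ≥ 0` + `π₁ = 1` + `H₂ = 0` ⇒ `S⁴` (KNOWN = Hamilton 1986 Thm 1.3 + homology of the models) -/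

/-- **Stub R (non-negative curvature-operator sphere recognition).** A compact, Hausdorff, second
countable, simply connected smooth 4-manifold carrying a `C^∞` Riemannian metric with non-negative
curvature operator (`HasNonnegativeCurvatureOperator`, the conclusion predicate of the BCRW fact)
and with `H₂(M; ℤ) = 0` (Mathlib's singular homology functor at `ULift ℤ`, verbatim the conclusion
of stub B) is diffeomorphic to the standard `S⁴`. From the tree's named fact
`Literature.Geometry.Riemannian.hamilton1986_nonnegCurvatureOperator_four` (Hamilton 1986 Thm 1.3,
simply connected case (a): `S⁴`, `ℂP²` or `S² × S²`) and `H₂(ℂP²; ℤ) = ℤ`, `H₂(S² × S²; ℤ) = ℤ²`;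
or: `π₁ = 1`, `H₂ = 0` make `M` a homotopy 4-sphere (Poincaré duality, Hurewicz, Whitehead) and
case (b) of the fact applies. [cite: Hamilton1986, Thm 1.3; HatcherAT2002, Cor. 4.33] -/
theorem stub_nonnegCurvatureSphereRecognition :
    ∀ (M : Type) [TopologicalSpace M] [T2Space M] [SecondCountableTopology M] [CompactSpace M]
      [ChartedSpace (EuclideanSpace ℝ (Fin 4)) M] [IsManifold (𝓡 4) ∞ M] [SimplyConnectedSpace M],
      (∃ g : PseudoRiemannianMetric (𝓡 4) ∞ (EuclideanSpace ℝ (Fin 4)) (TangentSpace (𝓡 4) : M → Type _),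
          g.IsRiemannian ∧ g.HasNonnegativeCurvatureOperator) →
      CategoryTheory.Limits.IsZero
          (((AlgebraicTopology.singularHomologyFunctor (ModuleCat.{0} ℤ) 2).obj
            (ModuleCat.of ℤ (ULift.{0} ℤ))).obj (TopCat.of M)) →
      Nonempty (M ≃ₘ⟮𝓡 4, 𝓡 4⟯ Metric.sphere (0 : EuclideanSpace ℝ (Fin 5)) 1) := by
  sorry

/-! ## The composition (kernel-checked; no `sorry` of its own) -/

/-- **The birth skeleton concludes the crux BY NAME**: `S1 → S2 → B → R → PolyhedralSphereRecognition`,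
the arrows discharged by the four stub constants. Given a simply connected certified `M`:
`M` is compact (PROVED: `|K| = ⋃_{s ∈ K.faces} conv s` is a finite union of compact sets and
`|K| ≃ₜ M`); install the Borel σ-algebra; S1 gives `D, v₀` and the family `g_ε`; S2 (BCRW) gives
`ε(4, v₀, D)` and then a metric `g'` with `Rm ≥ 0` on `M`; B gives `H₂(M; ℤ) = 0`; R returns
`M ≃ₘ S⁴`. -/
theorem PolyhedralSphereRecognition_of : PolyhedralSphereRecognition := by
  intro M _ _ _ _ _ _ hcert
  -- closedness from the certificate: a finite simplicial complex has compact underlying space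
  haveI : CompactSpace M := by
    obtain ⟨N, K, h, c, hfin, -⟩ := hcert
    have hK : IsCompact K.space := by
      rw [show K.space = ⋃ s ∈ K.faces, convexHull ℝ (s : Set (EuclideanSpace ℝ (Fin N))) from rfl]
      exact hfin.isCompact_biUnion fun s _ => Set.Finite.isCompact_convexHull ℝ s.finite_toSet
    haveI : CompactSpace K.space := isCompact_iff_compactSpace.mp hK
    exact h.compactSpace
  -- the Borel σ-algebra, to speak of Riemannian volume
  letI : MeasurableSpace M := borel M
  haveI : BorelSpace M := ⟨rfl⟩
  -- S1: almost-non-negative, non-collapsed smoothings on the same smooth structure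
  obtain ⟨D, v₀, hD, hv₀, happrox⟩ := stub_almostNonnegSmoothing M hcert
  -- S2: the BCRW threshold ε(4, v₀, D), then an `Rm ≥ 0` metric on `M`
  obtain ⟨ε, hε, hbcrw⟩ := stub_bcrwSmoothing 4 D v₀ hD hv₀
  obtain ⟨g, hg, hdiam, hvol, hRm⟩ := happrox ε hε
  obtain ⟨g', hg', hnn⟩ := hbcrw M g hg hdiam hvol hRm
  -- B: the certificate kills H₂;  R: Hamilton's `Rm ≥ 0` recognition
  exact stub_nonnegCurvatureSphereRecognition M ⟨g', hg', hnn⟩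
    (stub_certificateKillsSecondHomology M hcert)

end Summit.SmoothPoincare4.SmoothPoincare4.Cruxes.PolyhedralSphereRecognition.Birth

end
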